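import Literature.NumberTheory.EllipticCurves.ModularParamXFunction
import Literature.NumberTheory.EllipticCurves.ModularCurveLocalRingsAtPoints
import Literature.NumberTheory.EllipticCurves.ModularCurveCoordinateRationality
import Literature.NumberTheory.EllipticCurves.QExpansionCuspOrder
import HarnessLib

/-!
# `x = ℘_Λ(2πi∫f)` has a `q`-expansion fixed by `Aut(ℂ/ℚ(g₂, g₃))` (no `q`-expansion principle)

Topic `NumberTheory/EllipticCurves` (the rationality step of the "canonical model of `X₀(N)` at CM
points" chain).  Let `f ∈ S₂(Γ₀(N))` be nonzero **with rational Fourier coefficients**, `u = 2πi∫f`,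
`Λ = Λ(L) ⊇ Λ_f` a lattice, and `(F, G)` a presentation `℘_Λ(u)·G = F` by cusp forms on `Γ₀(N)`
(`ModularParamXFunction`); write `a, b ∈ ℂ⟦q⟧` for the `q`-expansions of `F, G`.  For a field
automorphism `σ` of `ℂ` fixing `g₂(L), g₃(L)` we prove

* `map_qExpansion_mul_eq` — **`σ(a)·b = σ(b)·a`**, i.e. the Laurent `q`-series `a/b` of the modular
  function `x = F/G ∈ K_N` is fixed by `σ` (`mapLaurent_xFn`).

Classically this is the statement that `x` lies in the canonical `ℚ`-model `ℚ(X₀(N)) = {rational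
`q`-expansions}` of the function field (Shimura 1971, §6.2, Prop. 6.9 and Thm. 7.14), proved there with
the `q`-expansion principle.  The proof here avoids it: (1) by the local representation theorem
(`ModularCurveLocalRingsAtPoints.exists_mul_aeval_eq_aeval`) `x = p(v)/q(v)` is a rational function of
the eight coordinate functions `v`, whose `q`-expansions are rational
(`ModularCurveCoordinateRationality`), so `σ(a/b) = p^σ(v)/q^σ(v)` is again an element `x^σ` of `K_N`,
presented by forms `F', G'`; (2) the cleared Weierstrass equation
`(bθa − aθb)² = e²b(4a³ − g₂ab² − g₃b³)` (`e` = expansion of `f`, `θ = q d/dq`; the tree's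
`odeFun_eq_zero_of_presentation`, `odeFun_eq_zero_iff`) is transported to `(σa, σb)` coefficientwise
(`map_odePS`, `f` rational) and then to the `q`-expansions of `(F'G, G'G)` along the cross relation
(`odePS_eq_zero_of_mul_eq`), so `x^σ` satisfies the analytic Weierstrass equation
(`deriv_div_sq_of_odeFun_eq_zero`); (3) by the uniqueness theorem for that equation
(`PeriodPair.exists_eq_weierstrassP_of_deriv_sq`) `x^σ = ℘_Λ(±u + c₀)`; (4) the order of `x` at the cusp
is negative (`|℘_Λ(u)| → ∞`) and is preserved by `σ`, whereas `℘_Λ(±u + c₀)` is bounded at the cusp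
unless `c₀ ∈ Λ` (`QExpansionCuspOrder`); hence `c₀ ∈ Λ`, `x^σ = ℘_Λ(u) = x`, and `σ(a/b) = a/b`.

Everything is proved; no named facts are introduced.

## References

* G. Shimura, *Introduction to the arithmetic theory of automorphic functions*, 1971, §6.2
  (Prop. 6.9), Thm. 7.14. [ShimuraIATAF1971]
* J. E. Cremona, *Algorithms for modular elliptic curves*, 2nd ed., 1997, §2.10.
  [CremonaAlgorithms1997]
-/

noncomputable section

open Complex Filter Topology Set Function PowerSeries
open UpperHalfPlane hiding I
open scoped Real Topology Manifold MatrixGroups PeriodPair ModularForm WithZero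
open ModularForm CongruenceSubgroup

open Literature.NumberTheory.EllipticCurves

namespace Literature.NumberTheory.EllipticCurves.ModularForms

variable {N : ℕ} [NeZero N] {k : ℤ}

/-! ### Preliminaries: `q`-expansions of cusp forms, products with a cusp form -/

omit [NeZero N] in
/-- A cusp form that is nonzero as a modular form has nonzero `q`-expansion. [folklore] -/
theorem qExpansion_ne_zero_of_ne_zero {G : CuspForm (Gamma0 N) k} (hG : (G : ModularForm (Gamma0 N) k) ≠ 0) :
    qExpansion 1 (⇑G) ≠ 0 := by
  intro h0
  apply hG
  rw [← qExpansionL_eq_zero_iff N, qExpansionL_def]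
  change ((qExpansion 1 ⇑G : ℂ⟦X⟧) : LaurentSeries ℂ) = 0
  rw [h0, PowerSeries.coe_zero]

omit [NeZero N] in
/-- Nonzero modular forms have nonzero `q`-expansion. [folklore] -/
theorem qExpansion_ne_zero_of_modularForm_ne_zero {k' : ℤ} {G : ModularForm (Gamma0 N) k'} (hG : G ≠ 0) :
    qExpansion 1 (⇑G) ≠ 0 := by
  intro h0
  apply hG
  rw [← qExpansionL_eq_zero_iff N, qExpansionL_def, h0, PowerSeries.coe_zero]

/-- The `q`-expansion of Mathlib's `CuspForm.mulModularForm G F'` (the cusp form `G·F'`). [folklore] -/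
theorem qExpansion_mulModularForm {k₁ k₂ : ℤ} (G : CuspForm (Gamma0 N) k₁) (F' : ModularForm (Gamma0 N) k₂) :
    qExpansion 1 (⇑(G.mulModularForm F')) = qExpansion 1 (⇑G) * qExpansion 1 (⇑F') := by
  rw [CuspForm.coe_mulModularForm]
  exact UpperHalfPlane.qExpansion_mul
    (ModularFormClass.analyticAt_cuspFunction_zero G one_pos (one_mem_strictPeriods_coe_gamma0 N))
    (ModularFormClass.analyticAt_cuspFunction_zero F' one_pos (one_mem_strictPeriods_coe_gamma0 N))

/-- Limits and blow-up are incompatible along `atImInfty`. [folklore] -/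
theorem not_tendsto_of_tendsto_norm_atTop {g : ℍ → ℂ} {c : ℂ} (h1 : Tendsto g atImInfty (𝓝 c))
    (h2 : Tendsto (fun τ ↦ ‖g τ‖) atImInfty atTop) : False := by
  have e1 : ∀ᶠ τ in atImInfty, ‖g τ‖ < ‖c‖ + 1 := by
    have := h1.norm
    exact this.eventually (gt_mem_nhds (by linarith [norm_nonneg c]))
  have e2 : ∀ᶠ τ in atImInfty, ‖c‖ + 1 ≤ ‖g τ‖ := h2.eventually (eventually_ge_atTop _)
  obtain ⟨τ, hτ1, hτ2⟩ := (e1.and e2).exists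
  linarith

omit [NeZero N] in
/-- `σ⁻¹ ∘ σ = id` on coefficients. [folklore] -/
theorem map_symm_map (σ : ℂ ≃+* ℂ) (x : ℂ⟦X⟧) :
    (x.map (σ : ℂ →+* ℂ)).map (σ.symm : ℂ →+* ℂ) = x := by
  ext n; simp [coeff_map]

/-! ### The cleared Weierstrass equation of a presentation, and its `σ`-transport -/

namespace IsXPresentation

variable {f : CuspForm (Gamma0 N) 2} {L : PeriodPair} {F G : CuspForm (Gamma0 N) k}

/-- The presentation, lifted to `Γ₁(N)` (same functions). [folklore] -/
theorem presentation_lift (h : IsXPresentation f L F G) :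
    ∀ τ : ℍ, eichlerIntegral f τ ∉ L.lattice →
      ℘[L] (eichlerIntegral f τ) * (liftToGamma1 N k G) τ = (liftToGamma1 N k F) τ := by
  intro τ hτ
  have hF : (⇑(liftToGamma1 N k F) : ℍ → ℂ) = ⇑F := coe_liftToGamma1_holds N k F
  have hG : (⇑(liftToGamma1 N k G) : ℍ → ℂ) = ⇑G := coe_liftToGamma1_holds N k G
  rw [hF, hG]
  exact h.2 τ hτ

/-- **The cleared Weierstrass equation on `q`-expansions**: with `a, b, e` the expansions of
`F, G, f` and `θ = q d/dq`, `(bθa − aθb)² − e²b(4a³ − g₂ab² − g₃b³) = 0` (the tree's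
`odeFun_eq_zero_of_presentation` and `odeFun_eq_zero_iff`). [cite: CremonaAlgorithms1997, §2.10] -/
theorem odePS_eq_zero (h : IsXPresentation f L F G) (hf : f ≠ 0) :
    (qExpansion 1 (⇑G) * thetaPS (qExpansion 1 (⇑F)) - qExpansion 1 (⇑F) * thetaPS (qExpansion 1 (⇑G))) ^ 2 -
      qExpansion 1 (⇑f) ^ 2 * qExpansion 1 (⇑G) *
        (4 * qExpansion 1 (⇑F) ^ 3 - PowerSeries.C L.g₂ * qExpansion 1 (⇑F) * qExpansion 1 (⇑G) ^ 2 -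
          PowerSeries.C L.g₃ * qExpansion 1 (⇑G) ^ 3) = 0 := by
  have hode := odeFun_eq_zero_of_presentation f hf L (liftToGamma1 N k F) (liftToGamma1 N k G) h.presentation_lift
  rw [odeFun_eq_zero_iff] at hode
  have hF : (⇑(liftToGamma1 N k F) : ℍ → ℂ) = ⇑F := coe_liftToGamma1_holds N k F
  have hG : (⇑(liftToGamma1 N k G) : ℍ → ℂ) = ⇑G := coe_liftToGamma1_holds N k G
  rw [hF, hG] at hode
  exact hode

/-- **`σ`-transport of the cleared equation**: for `f` with rational coefficients and `σ` fixing
`g₂, g₃`, the pair `(σa, σb)` satisfies the same equation. [folklore] -/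
theorem odePS_map_eq_zero (h : IsXPresentation f L F G) (hf : f ≠ 0)
    (hrat : ∀ n, ∃ q : ℚ, (q : ℂ) = cuspCoeff f n) (σ : ℂ ≃+* ℂ)
    (hg₂ : σ L.g₂ = L.g₂) (hg₃ : σ L.g₃ = L.g₃) :
    ((qExpansion 1 (⇑G)).map (σ : ℂ →+* ℂ) * thetaPS ((qExpansion 1 (⇑F)).map (σ : ℂ →+* ℂ)) -
        (qExpansion 1 (⇑F)).map (σ : ℂ →+* ℂ) * thetaPS ((qExpansion 1 (⇑G)).map (σ : ℂ →+* ℂ))) ^ 2 -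
      qExpansion 1 (⇑f) ^ 2 * (qExpansion 1 (⇑G)).map (σ : ℂ →+* ℂ) *
        (4 * (qExpansion 1 (⇑F)).map (σ : ℂ →+* ℂ) ^ 3 -
          PowerSeries.C L.g₂ * (qExpansion 1 (⇑F)).map (σ : ℂ →+* ℂ) * (qExpansion 1 (⇑G)).map (σ : ℂ →+* ℂ) ^ 2 -
          PowerSeries.C L.g₃ * (qExpansion 1 (⇑G)).map (σ : ℂ →+* ℂ) ^ 3) = 0 := by
  have hode := h.odePS_eq_zero hf
  have hmap := congrArg (PowerSeries.map (σ : ℂ →+* ℂ)) hode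
  rw [map_zero, thetaPS_def, thetaPS_def, map_odePS, qExpansion_map_eq_self_of_rat f hrat (σ := σ)] at hmap
  simp only [RingEquiv.coe_toRingHom, hg₂, hg₃] at hmap
  exact hmap

/-! ### The order of `x = F/G` at the cusp is negative -/

/-- **`ord_∞(a) < ord_∞(b)`**: `x = ℘_Λ(u)` blows up at the cusp, so the `q`-expansion of the
numerator has smaller order than that of the denominator. [folklore] -/
theorem qOrder_lt (h : IsXPresentation f L F G) (hf : f ≠ 0) : qOrder (⇑F) < qOrder (⇑G) := by
  by_contra hle
  rw [not_lt] at hle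
  have hF1 := isCuspFunction_one F
  have hG1 := isCuspFunction_one G
  have hF0 := qExpansion_ne_zero_of_ne_zero (h.numerator_ne_zero hf)
  have hG0 := qExpansion_ne_zero_of_ne_zero h.modularForm_ne_zero
  obtain ⟨c, hc⟩ := exists_tendsto_div_of_order_le hF1.periodic hF1.mdifferentiable hF1.isBoundedAtImInfty hF0
    hG1.periodic hG1.mdifferentiable hG1.isBoundedAtImInfty hG0 hle
  -- `F/G = x` for `im τ` large
  obtain ⟨T, hT⟩ := exists_forall_eichlerIntegral_smul_notMem f hf L 1
  have hev : ∀ᶠ τ : ℍ in atImInfty, F τ / G τ = ℘[L] (eichlerIntegral f τ) := by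
    have hG : ∀ᶠ τ : ℍ in atImInfty, G τ ≠ 0 :=
      eventually_ne_zero_atImInfty hG1.periodic hG1.mdifferentiable hG1.isBoundedAtImInfty hG0
    have hT' : ∀ᶠ τ : ℍ in atImInfty, eichlerIntegral f τ ∉ L.lattice := by
      rw [atImInfty, Filter.eventually_comap]
      filter_upwards [Filter.eventually_ge_atTop T] with t ht τ hτ
      have := hT τ (by rw [← hτ] at ht; exact ht)
      rwa [one_smul] at this
    filter_upwards [hG, hT'] with τ hGτ hτ
    rw [div_eq_iff hGτ, h.2 τ hτ]
  have hlim : Tendsto (fun τ : ℍ ↦ ℘[L] (eichlerIntegral f τ)) atImInfty (𝓝 c) := hc.congr' hev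
  exact not_tendsto_of_tendsto_norm_atTop hlim (tendsto_norm_weierstrassP_eichlerIntegral_atTop f hf L)

/-! ### Non-degeneracy: a quotient of cusp forms tied to `(σa, σb)` is not a constant root -/

/-- If cusp forms `F'', G''` (`G'' ≠ 0`) have expansions `a'', b''` with `a''·σb = b''·σa`, and
`F''/G''` is constant `= e₀` on `{G'' ≠ 0}`, then `x = F/G` is constant off its poles — impossible.
Hence `F''/G''` takes a value off any finite set, in particular off the roots of
`4X³ − g₂X − g₃`. [folklore] -/
theorem exists_nondegenerate (h : IsXPresentation f L F G) (hf : f ≠ 0) (σ : ℂ ≃+* ℂ) {k'' : ℤ}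
    {F'' G'' : CuspForm (Gamma0 N) k''} (hG''0 : (G'' : ModularForm (Gamma0 N) k'') ≠ 0)
    (hR : qExpansion 1 (⇑F'') * (qExpansion 1 (⇑G)).map (σ : ℂ →+* ℂ) =
      qExpansion 1 (⇑G'') * (qExpansion 1 (⇑F)).map (σ : ℂ →+* ℂ)) (A B : ℂ) :
    ∃ z : ℂ, 0 < z.im ∧ (⇑G'' ∘ ofComplex) z ≠ 0 ∧
      4 * ((⇑F'' ∘ ofComplex) z / (⇑G'' ∘ ofComplex) z) ^ 3 -
        A * ((⇑F'' ∘ ofComplex) z / (⇑G'' ∘ ofComplex) z) - B ≠ 0 := by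
  classical
  by_contra! hall
  have hF1 := isCuspFunction_one F''
  have hG1 := isCuspFunction_one G''
  have hG''ne : G'' ≠ 0 := fun h0 ↦ hG''0 (by rw [h0]; rfl)
  set V : Set ℂ := {z : ℂ | 0 < z.im ∧ (⇑G'' ∘ ofComplex) z ≠ 0} with hV
  have hVo : IsOpen V := hG1.differentiableOn_comp_ofComplex.continuousOn.isOpen_inter_preimage
    isOpen_upperHalfPlaneSet isOpen_compl_singleton
  have hVc : ({z : ℂ | 0 < z.im} \ V).Countable := by
    refine (countable_zeros_cuspForm (liftToGamma1 N k'' G'') (fun h0 ↦ hG''ne ?_)).mono ?_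
    · apply DFunLike.ext; intro τ
      have := DFunLike.congr_fun h0 τ
      rwa [coe_liftToGamma1_holds N k'' G''] at this
    · rintro z ⟨hz, hzV⟩
      refine ⟨hz, ?_⟩
      rw [coe_liftToGamma1_holds N k'' G'']
      by_contra h'; exact hzV ⟨hz, h'⟩
  have hVsub : V ⊆ {z : ℂ | 0 < z.im} := fun z hz ↦ hz.1
  have hVpre : IsPreconnected V := by
    have := isPreconnected_diff_of_countable convex_setOf_im_pos isOpen_upperHalfPlaneSet hVc
    rwa [Set.sdiff_sdiff_cancel_left hVsub] at this
  obtain ⟨z₁, hz₁⟩ := nonempty_diff_of_countable hVc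
  have hz₁V : z₁ ∈ V := by by_contra h'; exact hz₁.2 ⟨hz₁.1, h'⟩
  set R : Polynomial ℂ := 4 * Polynomial.X ^ 3 - Polynomial.C A * Polynomial.X - Polynomial.C B with hRdef
  have hR0 : R ≠ 0 := by
    intro h0
    have h3 : R.coeff 3 = 4 := by simp [hRdef]
    rw [h0, Polynomial.coeff_zero] at h3
    norm_num at h3
  set w : ℂ → ℂ := fun z ↦ (⇑F'' ∘ ofComplex) z / (⇑G'' ∘ ofComplex) z with hw
  have hwc : ContinuousOn w V := fun z hz ↦
    (((hF1.analyticAt_comp_ofComplex hz.1).div (hG1.analyticAt_comp_ofComplex hz.1) hz.2).continuousAt).continuousWithinAt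
  have hmaps : MapsTo w V (R.roots.toFinset : Set ℂ) := by
    intro z hz
    rw [Finset.mem_coe, Multiset.mem_toFinset, Polynomial.mem_roots hR0, Polynomial.IsRoot.def]
    simp only [hRdef, Polynomial.eval_sub, Polynomial.eval_mul, Polynomial.eval_pow, Polynomial.eval_X,
      Polynomial.eval_C, Polynomial.eval_ofNat]
    exact hall z hz.1 hz.2
  set e₀ : ℂ := w z₁ with he₀
  have hconst : ∀ z ∈ V, w z = e₀ := fun z hz ↦
    hVpre.constant_of_mapsTo (Finset.finite_toSet _).isDiscrete hwc hmaps hz hz₁V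
  -- `F'' = e₀ G''` on the half-plane
  have han : AnalyticOnNhd ℂ (fun z ↦ (⇑F'' ∘ ofComplex) z - e₀ * (⇑G'' ∘ ofComplex) z) {z : ℂ | 0 < z.im} :=
    fun z hz ↦ (hF1.analyticAt_comp_ofComplex hz).sub (analyticAt_const.mul (hG1.analyticAt_comp_ofComplex hz))
  have hev : (fun z ↦ (⇑F'' ∘ ofComplex) z - e₀ * (⇑G'' ∘ ofComplex) z) =ᶠ[𝓝 z₁] 0 := by
    filter_upwards [hVo.mem_nhds hz₁V] with z hz
    have h1 := hconst z hz
    simp only [hw] at h1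
    rw [div_eq_iff hz.2] at h1
    show (⇑F'' ∘ ofComplex) z - e₀ * (⇑G'' ∘ ofComplex) z = 0
    rw [h1, sub_self]
  have hzero := han.eqOn_zero_of_preconnected_of_eventuallyEq_zero convex_setOf_im_pos.isPreconnected hz₁.1 hev
  have hFG'' : (⇑F'' : ℍ → ℂ) = e₀ • ⇑G'' := by
    funext τ
    have := hzero τ.im_pos
    simp only [comp_apply, ofComplex_apply, Pi.zero_apply, sub_eq_zero] at this
    simpa using this
  -- `a'' = e₀ b''`, hence `σa = e₀ σb` and `a = σ⁻¹(e₀) b`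
  have hb''0 : qExpansion 1 (⇑G'') ≠ 0 := qExpansion_ne_zero_of_ne_zero hG''0
  have ha'' : qExpansion 1 (⇑F'') = e₀ • qExpansion 1 (⇑G'') := by
    rw [hFG'', UpperHalfPlane.qExpansion_smul
      (ModularFormClass.analyticAt_cuspFunction_zero G'' one_pos (one_mem_strictPeriods_coe_gamma0 N))]
  have hσab : (qExpansion 1 (⇑F)).map (σ : ℂ →+* ℂ) = e₀ • (qExpansion 1 (⇑G)).map (σ : ℂ →+* ℂ) := by
    rw [ha'', PowerSeries.smul_eq_C_mul] at hR
    rw [PowerSeries.smul_eq_C_mul]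
    apply mul_left_cancel₀ hb''0
    linear_combination -hR
  have hab : qExpansion 1 (⇑F) = σ.symm e₀ • qExpansion 1 (⇑G) := by
    have := congrArg (PowerSeries.map (σ.symm : ℂ →+* ℂ)) hσab
    rwa [PowerSeries.smul_eq_C_mul, map_mul, PowerSeries.map_C, map_symm_map, map_symm_map,
      RingEquiv.coe_toRingHom, ← PowerSeries.smul_eq_C_mul] at this
  -- hence `F = σ⁻¹(e₀) • G` as modular forms
  have hFG : (F : ModularForm (Gamma0 N) k) = σ.symm e₀ • (G : ModularForm (Gamma0 N) k) := by
    rw [← sub_eq_zero, ← qExpansionL_eq_zero_iff N, sub_eq_add_neg, qExpansionL_add, qExpansionL_neg,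
      qExpansionL_smul, qExpansionL_def, qExpansionL_def]
    change ((qExpansion 1 ⇑F : ℂ⟦X⟧) : LaurentSeries ℂ) + -(σ.symm e₀ • ((qExpansion 1 ⇑G : ℂ⟦X⟧) : LaurentSeries ℂ)) = 0
    rw [hab, PowerSeries.coe_smul, add_neg_cancel]
  -- so `x` is constant off its poles: contradiction
  have hGc1 := isCuspFunction_one G
  set W : Set ℂ := {z : ℂ | 0 < z.im ∧ eichlerIntegral f (ofComplex z) ∉ L.lattice} ∩
    {z : ℂ | 0 < z.im ∧ (⇑G ∘ ofComplex) z ≠ 0} with hW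
  have hWo : IsOpen W := (isOpen_setOf_eichlerIntegral_notMem_lattice f L).inter
    (hGc1.differentiableOn_comp_ofComplex.continuousOn.isOpen_inter_preimage isOpen_upperHalfPlaneSet
      isOpen_compl_singleton)
  have hGne : G ≠ 0 := h.1
  have hWc : ({z : ℂ | 0 < z.im} \ W).Countable := by
    refine ((countable_setOf_eichlerIntegral_mem_lattice f L hf).union
      (countable_zeros_cuspForm (liftToGamma1 N k G) (fun h0 ↦ hGne ?_))).mono ?_
    · apply DFunLike.ext; intro τ
      have := DFunLike.congr_fun h0 τ
      rwa [coe_liftToGamma1_holds N k G] at this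
    · rintro z ⟨hz, hzW⟩
      by_cases h1 : eichlerIntegral f (ofComplex z) ∈ L.lattice
      · exact Or.inl ⟨hz, h1⟩
      · right
        refine ⟨hz, ?_⟩
        rw [coe_liftToGamma1_holds N k G]
        by_contra h2
        exact hzW ⟨⟨hz, h1⟩, ⟨hz, h2⟩⟩
  obtain ⟨z₂, hz₂⟩ := nonempty_diff_of_countable hWc
  have hz₂W : z₂ ∈ W := by by_contra h'; exact hz₂.2 ⟨hz₂.1, h'⟩
  refine not_const_weierstrassP_eichlerIntegral f hf L hWo ⟨z₂, hz₂W⟩ (fun z hz ↦ hz.1) (σ.symm e₀)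
    fun z hz ↦ ?_
  have h1 := h.2 (ofComplex z) hz.1.2
  have hFz : F (ofComplex z) = (F : ModularForm (Gamma0 N) k) (ofComplex z) := rfl
  rw [hFz, hFG, ModularForm.IsGLPos.smul_apply, smul_eq_mul] at h1
  have hGz : (G : ℍ → ℂ) (ofComplex z) ≠ 0 := hz.2.2
  exact mul_right_cancel₀ hGz h1

/-! ### The main theorem -/

/-- A regular point of `x` high in the cusp. [folklore] -/
theorem exists_regular_point (hf : f ≠ 0) (L : PeriodPair) :
    ∃ τ₀ : ℍ, eichlerIntegral f τ₀ ∉ L.lattice := by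
  obtain ⟨T, hT⟩ := exists_forall_eichlerIntegral_smul_notMem f hf L 1
  set z₁ : ℂ := ((max T 1 + 1 : ℝ) : ℂ) * Complex.I with hz₁
  have hz₁im : z₁.im = max T 1 + 1 := by simp [hz₁]
  have hz₁pos : 0 < z₁.im := by rw [hz₁im]; positivity
  refine ⟨⟨z₁, hz₁pos⟩, ?_⟩
  have := hT ⟨z₁, hz₁pos⟩ (by change T ≤ z₁.im; rw [hz₁im]; linarith [le_max_left T 1])
  rwa [one_smul] at this

/-- **Rationality of `x = ℘_Λ(2πi∫f)`: `σ(a)·b = σ(b)·a`.**  For a nonzero `f ∈ S₂(Γ₀(N))` with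
rational coefficients, a lattice `Λ(L) ⊇ Λ_f`, a presentation `℘_Λ(u)G = F` by cusp forms on
`Γ₀(N)` with `q`-expansions `a, b`, and a field automorphism `σ` of `ℂ` fixing `g₂(L), g₃(L)`:
the Laurent series `a/b` is fixed by `σ`. [cite: ShimuraIATAF1971, Prop. 6.9 and Thm. 7.14] -/
theorem map_qExpansion_mul_eq (h : IsXPresentation f L F G) (hf : f ≠ 0)
    (hrat : ∀ n, ∃ q : ℚ, (q : ℂ) = cuspCoeff f n) (σ : ℂ ≃+* ℂ)
    (hg₂ : σ L.g₂ = L.g₂) (hg₃ : σ L.g₃ = L.g₃) :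
    (qExpansion 1 (⇑F)).map (σ : ℂ →+* ℂ) * qExpansion 1 (⇑G) =
      (qExpansion 1 (⇑G)).map (σ : ℂ →+* ℂ) * qExpansion 1 (⇑F) := by
  classical
  set a := qExpansion 1 (⇑F) with ha
  set b := qExpansion 1 (⇑G) with hb
  have hF0 : (F : ModularForm (Gamma0 N) k) ≠ 0 := h.numerator_ne_zero hf
  have hG0 := h.modularForm_ne_zero
  have ha0 : a ≠ 0 := qExpansion_ne_zero_of_ne_zero hF0
  have hb0 : b ≠ 0 := qExpansion_ne_zero_of_ne_zero hG0
  have hσinj : Injective (σ : ℂ →+* ℂ) := σ.injective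
  have hσa0 : a.map (σ : ℂ →+* ℂ) ≠ 0 := fun h0 ↦ ha0 (by
    have := congrArg (PowerSeries.map (σ.symm : ℂ →+* ℂ)) h0
    rwa [map_symm_map, map_zero] at this)
  have hσb0 : b.map (σ : ℂ →+* ℂ) ≠ 0 := fun h0 ↦ hb0 (by
    have := congrArg (PowerSeries.map (σ.symm : ℂ →+* ℂ)) h0
    rwa [map_symm_map, map_zero] at this)
  -- Step 1: a regular point and the local representation `x·q(v) = p(v)`
  obtain ⟨τ₀, hτ₀⟩ := exists_regular_point (f := f) hf L
  have hmem := h.xFn_mem_pointPlace τ₀ hτ₀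
  obtain ⟨p, q, hq, hpq⟩ := exists_mul_aeval_eq_aeval τ₀ hmem
  set P : modularFunctionField N := MvPolynomial.aeval (coordFn N) p with hP
  set Q : modularFunctionField N := MvPolynomial.aeval (coordFn N) q with hQ
  have hQ0 : Q ≠ 0 := by
    intro h0
    have := pointValuation_aeval_eq_one_of_not_mem hq
    rw [← hQ, h0, map_zero] at this
    exact zero_ne_one this
  -- Laurent series bookkeeping
  have hx : ((h.xFn : modularFunctionField N) : LaurentSeries ℂ) =
      (a : LaurentSeries ℂ) / (b : LaurentSeries ℂ) := rfl
  have hxPQ : ((h.xFn : modularFunctionField N) : LaurentSeries ℂ) =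
      (P : LaurentSeries ℂ) / (Q : LaurentSeries ℂ) := by
    have hQL : (Q : LaurentSeries ℂ) ≠ 0 := fun h0 ↦ hQ0 (Subtype.ext h0)
    rw [eq_div_iff hQL]
    exact congrArg Subtype.val hpq
  -- Step 2: the conjugate element `x^σ = p^σ(v)/q^σ(v) ∈ K_N`
  set σ' : ℂ →+* ℂ := (σ : ℂ →+* ℂ) with hσ'
  set Pσ : modularFunctionField N := MvPolynomial.aeval (coordFn N) (MvPolynomial.map σ' p) with hPσ
  set Qσ : modularFunctionField N := MvPolynomial.aeval (coordFn N) (MvPolynomial.map σ' q) with hQσ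
  have hPσL : (Pσ : LaurentSeries ℂ) = mapLaurent σ' (P : LaurentSeries ℂ) := (mapLaurent_aeval σ' p).symm
  have hQσL : (Qσ : LaurentSeries ℂ) = mapLaurent σ' (Q : LaurentSeries ℂ) := (mapLaurent_aeval σ' q).symm
  have hQσ0 : (Qσ : LaurentSeries ℂ) ≠ 0 := by
    rw [hQσL]
    exact (map_ne_zero (mapLaurent σ')).mpr fun h0 ↦ hQ0 (Subtype.ext h0)
  have hQσ0' : Qσ ≠ 0 := fun h0 ↦ hQσ0 (by rw [h0]; rfl)
  set Xσ : modularFunctionField N := Pσ / Qσ with hXσdef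
  have hXσL : (Xσ : LaurentSeries ℂ) =
      ((a.map σ' : ℂ⟦X⟧) : LaurentSeries ℂ) / ((b.map σ' : ℂ⟦X⟧) : LaurentSeries ℂ) := by
    have : (Xσ : LaurentSeries ℂ) = (Pσ : LaurentSeries ℂ) / (Qσ : LaurentSeries ℂ) := rfl
    rw [this, hPσL, hQσL, ← map_div₀, ← hxPQ, hx, map_div₀, mapLaurent_coe_powerSeries,
      mapLaurent_coe_powerSeries]
  -- Step 3: forms presenting `x^σ` and the cross relation
  obtain ⟨k', F', G', hG'0, hXσ⟩ := Xσ.2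
  set a' := qExpansion 1 (⇑F') with ha'
  set b' := qExpansion 1 (⇑G') with hb'
  have hb'0 : b' ≠ 0 := qExpansion_ne_zero_of_modularForm_ne_zero hG'0
  have hσbL : ((b.map σ' : ℂ⟦X⟧) : LaurentSeries ℂ) ≠ 0 := fun h0 ↦ hσb0
    (HahnSeries.ofPowerSeries_injective (Γ := ℤ) (R := ℂ) (h0.trans (map_zero _).symm))
  have hcross : a' * b.map σ' = b' * a.map σ' := by
    apply HahnSeries.ofPowerSeries_injective (Γ := ℤ) (R := ℂ)
    change ((a' * b.map σ' : ℂ⟦X⟧) : LaurentSeries ℂ) = ((b' * a.map σ' : ℂ⟦X⟧) : LaurentSeries ℂ)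
    rw [PowerSeries.coe_mul, PowerSeries.coe_mul]
    rw [hXσL, qExpansionL_def, qExpansionL_def, div_mul_eq_mul_div, div_eq_iff hσbL] at hXσ
    rw [← ha', ← hb'] at hXσ
    linear_combination hXσ.symm
  have ha'0 : a' ≠ 0 := by
    intro h0
    rw [h0, zero_mul] at hcross
    exact (mul_ne_zero hb'0 hσa0) hcross.symm
  -- Step 4: cusp forms `F'' = G·F'`, `G'' = G·G'` (Mathlib's `CuspForm.mulModularForm`)
  set F'' : CuspForm (Gamma0 N) (k + k') := G.mulModularForm F' with hF''
  set G'' : CuspForm (Gamma0 N) (k + k') := G.mulModularForm G' with hG''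
  have ha'' : qExpansion 1 (⇑F'') = a' * b := by rw [hF'', qExpansion_mulModularForm, mul_comm]
  have hb'' : qExpansion 1 (⇑G'') = b' * b := by rw [hG'', qExpansion_mulModularForm, mul_comm]
  have ha''0 : qExpansion 1 (⇑F'') ≠ 0 := by rw [ha'']; exact mul_ne_zero ha'0 hb0
  have hb''0 : qExpansion 1 (⇑G'') ≠ 0 := by rw [hb'']; exact mul_ne_zero hb'0 hb0
  have hG''0 : (G'' : ModularForm (Gamma0 N) (k + k')) ≠ 0 := by
    intro h0
    apply hb''0
    have hc : (⇑G'' : ℍ → ℂ) = (0 : ℂ) • ⇑G'' := by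
      have : (⇑G'' : ℍ → ℂ) = ⇑(G'' : ModularForm (Gamma0 N) (k + k')) := rfl
      rw [zero_smul, this, h0]; rfl
    rw [hc, UpperHalfPlane.qExpansion_smul
      (ModularFormClass.analyticAt_cuspFunction_zero G'' one_pos (one_mem_strictPeriods_coe_gamma0 N)), zero_smul]
  have hR'' : qExpansion 1 (⇑F'') * b.map σ' = qExpansion 1 (⇑G'') * a.map σ' := by
    rw [ha'', hb'']
    linear_combination b * hcross
  -- Step 5: the cleared Weierstrass equation for `(a'', b'')`
  have hodeσ := h.odePS_map_eq_zero hf hrat σ hg₂ hg₃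
  have hode'' := odePS_eq_zero_of_mul_eq hσb0 hR'' L.g₂ L.g₃ hodeσ
  -- Step 6: the function identity and the analytic equation for `w = F''/G''`
  set F₁ := liftToGamma1 N (k + k') F'' with hF₁
  set G₁ := liftToGamma1 N (k + k') G'' with hG₁
  have hcF : (⇑F₁ : ℍ → ℂ) = ⇑F'' := coe_liftToGamma1_holds N (k + k') F''
  have hcG : (⇑G₁ : ℍ → ℂ) = ⇑G'' := coe_liftToGamma1_holds N (k + k') G''
  have hfun : (⇑G₁ * (fun τ : ℍ ↦ deriv (⇑F₁ ∘ ofComplex) τ) - ⇑F₁ * (fun τ : ℍ ↦ deriv (⇑G₁ ∘ ofComplex) τ)) *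
        (⇑G₁ * (fun τ : ℍ ↦ deriv (⇑F₁ ∘ ofComplex) τ) - ⇑F₁ * (fun τ : ℍ ↦ deriv (⇑G₁ ∘ ofComplex) τ)) -
      ((2 * π * I) ^ 2 : ℂ) • (⇑f * ⇑f * ⇑G₁ *
        ((4 : ℂ) • (⇑F₁ * ⇑F₁ * ⇑F₁) - L.g₂ • (⇑F₁ * ⇑G₁ * ⇑G₁) - L.g₃ • (⇑G₁ * ⇑G₁ * ⇑G₁))) = 0 := by
    rw [odeFun_eq_zero_iff, hcF, hcG]
    exact hode''
  set U : ℂ → ℂ := fun z ↦ eichlerIntegral f (ofComplex z) with hU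
  set w : ℂ → ℂ := fun z ↦ (⇑F'' ∘ ofComplex) z / (⇑G'' ∘ ofComplex) z with hw
  set V : Set ℂ := {z : ℂ | 0 < z.im ∧ (⇑G'' ∘ ofComplex) z ≠ 0} with hV
  have hF''1 := isCuspFunction_one F''
  have hG''1 := isCuspFunction_one G''
  have hode_an : ∀ z ∈ V, deriv w z ^ 2 = deriv U z ^ 2 * (4 * w z ^ 3 - L.g₂ * w z - L.g₃) := by
    intro z hz
    have := deriv_div_sq_of_odeFun_eq_zero f F₁ G₁ L.g₂ L.g₃ hfun hz.1 (by rw [hcG]; exact hz.2)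
    rw [hcF, hcG] at this
    exact this
  -- Step 7: uniqueness for the Weierstrass equation
  have hVo : IsOpen V := hG''1.differentiableOn_comp_ofComplex.continuousOn.isOpen_inter_preimage
    isOpen_upperHalfPlaneSet isOpen_compl_singleton
  have hVsub : V ⊆ {z : ℂ | 0 < z.im} := fun z hz ↦ hz.1
  have hG''ne : G'' ≠ 0 := fun h0 ↦ hG''0 (by rw [h0]; rfl)
  have hcount : ({z : ℂ | 0 < z.im} \ V).Countable := by
    refine (countable_zeros_cuspForm G₁ (fun h0 ↦ hG''ne ?_)).mono ?_
    · apply DFunLike.ext; intro τ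
      have := DFunLike.congr_fun h0 τ
      rwa [hcG] at this
    · rintro z ⟨hz, hzV⟩
      refine ⟨hz, ?_⟩
      rw [hcG]
      by_contra h'; exact hzV ⟨hz, h'⟩
  have hwan : AnalyticOnNhd ℂ w V := fun z hz ↦
    (hF''1.analyticAt_comp_ofComplex hz.1).div (hG''1.analyticAt_comp_ofComplex hz.1) hz.2
  have hvan : AnalyticOnNhd ℂ U V := fun z hz ↦ analyticAt_eichlerIntegral_comp_ofComplex f hz.1
  obtain ⟨z₀, hz₀im, hz₀G, h0⟩ := h.exists_nondegenerate hf σ hG''0 hR'' L.g₂ L.g₃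
  obtain ⟨ε, hε, c₀, -, hglob⟩ := L.exists_eq_weierstrassP_of_deriv_sq convex_setOf_im_pos
    isOpen_upperHalfPlaneSet hVo hVsub hcount hwan hvan hode_an ⟨hz₀im, hz₀G⟩ h0
  -- Step 8: `c₀ ∈ Λ` by comparing orders at the cusp
  have hc₀ : c₀ ∈ L.lattice := by
    by_contra hc₀
    -- `w → ℘(c₀)` at `i∞`
    have hu0 : Tendsto (eichlerIntegral f) atImInfty (𝓝 0) := (isCuspFunction_eichlerIntegral f).isZeroAtImInfty
    have hlin : Tendsto (fun τ : ℍ ↦ ε * eichlerIntegral f τ + c₀) atImInfty (𝓝 c₀) := by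
      have := (hu0.const_mul ε).add_const c₀
      rwa [mul_zero, zero_add] at this
    have h℘c : ContinuousAt ℘[L] c₀ := (L.analyticOnNhd_weierstrassP c₀ hc₀).continuousAt
    have hcomp : Tendsto (fun τ : ℍ ↦ ℘[L] (ε * eichlerIntegral f τ + c₀)) atImInfty (𝓝 (℘[L] c₀)) :=
      h℘c.tendsto.comp hlin
    have hlimw : Tendsto (fun τ : ℍ ↦ F'' τ / G'' τ) atImInfty (𝓝 (℘[L] c₀)) := by
      apply hcomp.congr'
      have hV' : ∀ᶠ τ : ℍ in atImInfty, G'' τ ≠ 0 :=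
        eventually_ne_zero_atImInfty hG''1.periodic hG''1.mdifferentiable hG''1.isBoundedAtImInfty hb''0
      have hΛ' : ∀ᶠ τ : ℍ in atImInfty, ε * eichlerIntegral f τ + c₀ ∉ L.lattice :=
        hlin.eventually (L.isClosed_lattice.isOpen_compl.mem_nhds hc₀)
      filter_upwards [hV', hΛ'] with τ hGτ hΛτ
      have hzV : (τ : ℂ) ∈ V := ⟨τ.im_pos, by simpa [comp_apply, ofComplex_apply] using hGτ⟩
      have := hglob (τ : ℂ) hzV (by simpa [hU, ofComplex_apply] using hΛτ)
      simp only [hw, hU, comp_apply, ofComplex_apply] at this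
      exact this.symm
    -- but `ord a'' < ord b''`
    have hlt : qOrder (⇑F'') < qOrder (⇑G'') := by
      have h1 := order_add_order_eq hR''
      rw [order_map_eq hσinj, order_map_eq hσinj] at h1
      have hq := h.qOrder_lt hf
      have e1 : (qExpansion 1 ⇑F'').order = (qOrder ⇑F'' : ℕ∞) :=
        (ENat.coe_toNat (order_eq_top.not.mpr ha''0)).symm
      have e2 : (qExpansion 1 ⇑G'').order = (qOrder ⇑G'' : ℕ∞) :=
        (ENat.coe_toNat (order_eq_top.not.mpr hb''0)).symm
      have e3 : a.order = (qOrder ⇑F : ℕ∞) := (ENat.coe_toNat (order_eq_top.not.mpr ha0)).symm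
      have e4 : b.order = (qOrder ⇑G : ℕ∞) := (ENat.coe_toNat (order_eq_top.not.mpr hb0)).symm
      rw [e1, e2, e3, e4, ← Nat.cast_add, ← Nat.cast_add, Nat.cast_inj] at h1
      omega
    exact not_tendsto_of_tendsto_norm_atTop hlimw
      (tendsto_norm_div_atTop_of_order_lt hF''1.periodic hF''1.mdifferentiable hF''1.isBoundedAtImInfty ha''0
        hG''1.periodic hG''1.mdifferentiable hG''1.isBoundedAtImInfty hb''0 hlt)
  -- Step 9: on the regular set, `w = x`; hence `F''·G = G''·F`
  set W : Set ℂ := V ∩ {z : ℂ | 0 < z.im ∧ eichlerIntegral f (ofComplex z) ∉ L.lattice} with hWdef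
  have hWo : IsOpen W := hVo.inter (isOpen_setOf_eichlerIntegral_notMem_lattice f L)
  have hWc : ({z : ℂ | 0 < z.im} \ W).Countable := by
    refine (hcount.union (countable_setOf_eichlerIntegral_mem_lattice f L hf)).mono ?_
    rintro z ⟨hz, hzW⟩
    by_cases h1 : z ∈ V
    · right
      refine ⟨hz, ?_⟩
      by_contra h2
      exact hzW ⟨h1, ⟨hz, h2⟩⟩
    · exact Or.inl ⟨hz, h1⟩
  obtain ⟨z₂, hz₂⟩ := nonempty_diff_of_countable hWc
  have hz₂W : z₂ ∈ W := by by_contra h'; exact hz₂.2 ⟨hz₂.1, h'⟩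
  have hwx : ∀ z ∈ W, w z = ℘[L] (U z) := by
    intro z hz
    have hUz : U z ∉ L.lattice := hz.2.2
    have hεU : ε * U z + c₀ ∉ L.lattice := by
      intro hmem
      have h1 : ε * U z ∈ L.lattice := by
        have := L.lattice.sub_mem hmem hc₀
        rwa [add_sub_cancel_right] at this
      rcases hε with rfl | rfl
      · exact hUz (by simpa using h1)
      · exact hUz (by simpa using L.lattice.neg_mem h1)
    rw [hglob z hz.1 hεU, show ε * U z + c₀ = ε * U z + ((⟨c₀, hc₀⟩ : L.lattice) : ℂ) from rfl,
      L.weierstrassP_add_coe]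
    rcases hε with rfl | rfl
    · rw [one_mul]
    · rw [neg_one_mul, L.weierstrassP_neg]
  set D : ℂ → ℂ := fun z ↦ (⇑F'' ∘ ofComplex) z * (⇑G ∘ ofComplex) z - (⇑G'' ∘ ofComplex) z * (⇑F ∘ ofComplex) z
    with hD
  have hF1 := isCuspFunction_one F
  have hG1 := isCuspFunction_one G
  have hDan : AnalyticOnNhd ℂ D {z : ℂ | 0 < z.im} := fun z hz ↦
    ((hF''1.analyticAt_comp_ofComplex hz).mul (hG1.analyticAt_comp_ofComplex hz)).sub
      ((hG''1.analyticAt_comp_ofComplex hz).mul (hF1.analyticAt_comp_ofComplex hz))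
  have hDev : D =ᶠ[𝓝 z₂] 0 := by
    filter_upwards [hWo.mem_nhds hz₂W] with z hz
    have h1 := hwx z hz
    simp only [hw] at h1
    rw [div_eq_iff hz.1.2] at h1
    have h2 := h.apply_eq_mul hz.2.2
    show (⇑F'' ∘ ofComplex) z * (⇑G ∘ ofComplex) z - (⇑G'' ∘ ofComplex) z * (⇑F ∘ ofComplex) z = 0
    rw [h1, h2]; ring
  have hDzero := hDan.eqOn_zero_of_preconnected_of_eventuallyEq_zero convex_setOf_im_pos.isPreconnected
    hz₂.1 hDev
  have hfunc : (⇑F'' : ℍ → ℂ) * ⇑G = ⇑G'' * ⇑F := by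
    funext τ
    have := hDzero τ.im_pos
    simp only [hD, comp_apply, ofComplex_apply, Pi.zero_apply, sub_eq_zero] at this
    exact this
  have ha''b : qExpansion 1 (⇑F'') * b = qExpansion 1 (⇑G'') * a := by
    have hAF := ModularFormClass.analyticAt_cuspFunction_zero F'' one_pos (one_mem_strictPeriods_coe_gamma0 N)
    have hAG := ModularFormClass.analyticAt_cuspFunction_zero G'' one_pos (one_mem_strictPeriods_coe_gamma0 N)
    have hAF0 := ModularFormClass.analyticAt_cuspFunction_zero F one_pos (one_mem_strictPeriods_coe_gamma0 N)
    have hAG0 := ModularFormClass.analyticAt_cuspFunction_zero G one_pos (one_mem_strictPeriods_coe_gamma0 N)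
    rw [hb, ha, ← UpperHalfPlane.qExpansion_mul hAF hAG0, ← UpperHalfPlane.qExpansion_mul hAG hAF0, hfunc]
  -- Step 10: conclude
  have key : qExpansion 1 (⇑G'') * (a.map σ' * b) = qExpansion 1 (⇑G'') * (b.map σ' * a) := by
    linear_combination (-b) * hR'' + b.map σ' * ha''b
  exact mul_left_cancel₀ hb''0 key

/-- **`σ` fixes the Laurent `q`-series of `x = F/G`.** [cite: ShimuraIATAF1971, Prop. 6.9] -/
theorem mapLaurent_xFn (h : IsXPresentation f L F G) (hf : f ≠ 0)
    (hrat : ∀ n, ∃ q : ℚ, (q : ℂ) = cuspCoeff f n) (σ : ℂ ≃+* ℂ)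
    (hg₂ : σ L.g₂ = L.g₂) (hg₃ : σ L.g₃ = L.g₃) :
    mapLaurent (σ : ℂ →+* ℂ) ((h.xFn : modularFunctionField N) : LaurentSeries ℂ) = h.xFn := by
  have hx : ((h.xFn : modularFunctionField N) : LaurentSeries ℂ) =
      ((qExpansion 1 (⇑F) : ℂ⟦X⟧) : LaurentSeries ℂ) / ((qExpansion 1 (⇑G) : ℂ⟦X⟧) : LaurentSeries ℂ) := rfl
  have hb0 : qExpansion 1 (⇑G) ≠ 0 := qExpansion_ne_zero_of_ne_zero h.modularForm_ne_zero
  have hσb0 : (qExpansion 1 (⇑G)).map (σ : ℂ →+* ℂ) ≠ 0 := fun h0 ↦ hb0 (by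
    have := congrArg (PowerSeries.map (σ.symm : ℂ →+* ℂ)) h0
    rwa [map_symm_map, map_zero] at this)
  have hbL : ((qExpansion 1 (⇑G) : ℂ⟦X⟧) : LaurentSeries ℂ) ≠ 0 := fun h0 ↦ hb0
    (HahnSeries.ofPowerSeries_injective (Γ := ℤ) (R := ℂ) (h0.trans (map_zero _).symm))
  have hσbL : (((qExpansion 1 (⇑G)).map (σ : ℂ →+* ℂ) : ℂ⟦X⟧) : LaurentSeries ℂ) ≠ 0 := fun h0 ↦ hσb0
    (HahnSeries.ofPowerSeries_injective (Γ := ℤ) (R := ℂ) (h0.trans (map_zero _).symm))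
  rw [hx, map_div₀, mapLaurent_coe_powerSeries, mapLaurent_coe_powerSeries, div_eq_div_iff hσbL hbL,
    ← PowerSeries.coe_mul, ← PowerSeries.coe_mul, h.map_qExpansion_mul_eq hf hrat σ hg₂ hg₃, mul_comm]

end IsXPresentation

end Literature.NumberTheory.EllipticCurves.ModularForms

end
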